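import Summits.Parity.GeneralizedHardyLittlewood.Theorems.PrimeLevelFamEdgeMomentsBeyondDiagonalLayersRegroup
import HarnessLib

/-!
# Route `PrimeLevelFamEdge`, crux K_A `MomentsBeyondDiagonal` (stmt-Parity-20007), line «petersson_layers» v4:
# regrouping on the HYPERBOLIC effective box — the `v = n₁n₂` interval shrinks to the support (assembly step E2 of `stub_farP`)

After `…LayersEffectiveBox` (p822097) the print band of `stub_farP` is a statement about the order sums restricted to the
EFFECTIVE box `d₁n₁'·d₂n₂' ≤ Y`, i.e. with AFE-side coefficients `B(n₁', n₂')` SUPPORTED on the hyperbola `n₁'n₂' ≤ Y' = Y/(d₁d₂)`.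
`…LayersRegroup.sum_four_eq_bilinear_fiber(_of_support)` regroups a four-variable form on a product box into a bilinear form with
`v = n₁n₂ ≤ Y₁Y₂`; for Pascadi / the Fourier floor the `v`-interval must be SHORT (`≤ qr`), so here the `v`-range is cut down to
the support:
* `fiber_sum_eq_zero_of_lt`: the convolution coefficient `β_v = Σ_{n₁n₂ = v} B` vanishes for `v > Y'` when `B` does;
* **`sum_four_eq_bilinear_fiber_hyperbolic`**: `Σ A(m₁,m₂) B(n₁,n₂) K(m₁m₂, n₁n₂) = Σ_{u ≤ X₁X₂} Σ_{v ≤ min Y' (Y₁Y₂)} α_u β_v K(u,v)`;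
* `sum_four_eq_bilinear_fiber_hyperbolic_of_support`: the same under a kernel-replacement hypothesis on the support of `A·B`.
Proof only (def-free helper); K_A NOT proved; nothing about Landau–Siegel zeros.
-/

noncomputable section

open Finset

namespace Summit.Parity.GeneralizedHardyLittlewood.Theorems.MomentsBeyondDiagonal.Layers

/-- If `B(n₁, n₂) = 0` whenever `n₁n₂ > Y'`, then the fibre sum `Σ_{(n₁,n₂) ∈ box, n₁n₂ = v} B = 0` for `v > Y'`. [folklore] -/
theorem fiber_sum_eq_zero_of_lt (Y₁ Y₂ : ℕ) {Y' : ℕ} (B : ℕ → ℕ → ℂ) (hB : ∀ n₁ n₂ : ℕ, Y' < n₁ * n₂ → B n₁ n₂ = 0)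
    {v : ℕ} (hv : Y' < v) :
    ∑ p ∈ (Icc 1 Y₁ ×ˢ Icc 1 Y₂).filter (fun p : ℕ × ℕ ↦ p.1 * p.2 = v), B p.1 p.2 = 0 := by
  refine sum_eq_zero fun p hp ↦ ?_
  have h := (mem_filter.mp hp).2
  exact hB p.1 p.2 (h ▸ hv)

/-- **Regrouping on the hyperbolic box**: if `B` is supported on `n₁n₂ ≤ Y'`, the four-variable form with kernel `K(m₁m₂, n₁n₂)`
is the bilinear form `Σ_{u ≤ X₁X₂} Σ_{v ≤ min Y' (Y₁Y₂)} α_u β_v K(u, v)`, `α_u = Σ_{m₁m₂=u} A`, `β_v = Σ_{n₁n₂=v} B` — the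
`v`-interval is the SUPPORT length, not the box product. [folklore] -/
theorem sum_four_eq_bilinear_fiber_hyperbolic (X₁ X₂ Y₁ Y₂ Y' : ℕ) (A B : ℕ → ℕ → ℂ) (K : ℕ → ℕ → ℂ)
    (hB : ∀ n₁ n₂ : ℕ, Y' < n₁ * n₂ → B n₁ n₂ = 0) :
    ∑ m₁ ∈ Icc 1 X₁, ∑ n₁ ∈ Icc 1 Y₁, ∑ m₂ ∈ Icc 1 X₂, ∑ n₂ ∈ Icc 1 Y₂, A m₁ m₂ * B n₁ n₂ * K (m₁ * m₂) (n₁ * n₂) =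
      ∑ u ∈ Icc 1 (X₁ * X₂), ∑ v ∈ Icc 1 (min Y' (Y₁ * Y₂)),
        (∑ p ∈ (Icc 1 X₁ ×ˢ Icc 1 X₂).filter (fun p : ℕ × ℕ ↦ p.1 * p.2 = u), A p.1 p.2) *
          (∑ p ∈ (Icc 1 Y₁ ×ˢ Icc 1 Y₂).filter (fun p : ℕ × ℕ ↦ p.1 * p.2 = v), B p.1 p.2) * K u v := by
  rw [sum_four_eq_bilinear_fiber]
  refine sum_congr rfl fun u _ ↦ ?_
  symm
  refine sum_subset (fun v hv ↦ ?_) (fun v hv hv' ↦ ?_)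
  · simp only [mem_Icc] at hv ⊢
    exact ⟨hv.1, hv.2.trans (min_le_right _ _)⟩
  · simp only [mem_Icc, not_and, not_le] at hv hv'
    have hlt : Y' < v := by
      rcases min_lt_iff.mp (hv' hv.1) with h | h
      · exact h
      · exact absurd hv.2 (not_le.mpr h)
    rw [fiber_sum_eq_zero_of_lt Y₁ Y₂ B hB hlt, mul_zero, zero_mul]

/-- **Regrouping on the hyperbolic box under a support hypothesis** (kernel `κ(m₁,n₁,m₂,n₂)`, e.g. `S(m₁n₁, m₂n₂; c)`, equal to
`K(m₁m₂, n₁n₂)` wherever `A·B ≠ 0`; `B` supported on `n₁n₂ ≤ Y'`). [folklore] -/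
theorem sum_four_eq_bilinear_fiber_hyperbolic_of_support (X₁ X₂ Y₁ Y₂ Y' : ℕ) (A B : ℕ → ℕ → ℂ)
    (κ : ℕ → ℕ → ℕ → ℕ → ℂ) (K : ℕ → ℕ → ℂ)
    (hB : ∀ n₁ n₂ : ℕ, Y' < n₁ * n₂ → B n₁ n₂ = 0)
    (hgood : ∀ m₁ ∈ Icc 1 X₁, ∀ m₂ ∈ Icc 1 X₂, ∀ n₁ ∈ Icc 1 Y₁, ∀ n₂ ∈ Icc 1 Y₂, A m₁ m₂ * B n₁ n₂ ≠ 0 →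
      κ m₁ n₁ m₂ n₂ = K (m₁ * m₂) (n₁ * n₂)) :
    ∑ m₁ ∈ Icc 1 X₁, ∑ n₁ ∈ Icc 1 Y₁, ∑ m₂ ∈ Icc 1 X₂, ∑ n₂ ∈ Icc 1 Y₂, A m₁ m₂ * B n₁ n₂ * κ m₁ n₁ m₂ n₂ =
      ∑ u ∈ Icc 1 (X₁ * X₂), ∑ v ∈ Icc 1 (min Y' (Y₁ * Y₂)),
        (∑ p ∈ (Icc 1 X₁ ×ˢ Icc 1 X₂).filter (fun p : ℕ × ℕ ↦ p.1 * p.2 = u), A p.1 p.2) *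
          (∑ p ∈ (Icc 1 Y₁ ×ˢ Icc 1 Y₂).filter (fun p : ℕ × ℕ ↦ p.1 * p.2 = v), B p.1 p.2) * K u v := by
  rw [sum_four_congr_support _ _ _ _ A B κ K hgood]
  exact sum_four_eq_bilinear_fiber_hyperbolic X₁ X₂ Y₁ Y₂ Y' A B K hB

end Summit.Parity.GeneralizedHardyLittlewood.Theorems.MomentsBeyondDiagonal.Layers

end
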